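import Mathlib.Analysis.SpecialFunctions.Pow.Real
import HarnessLib

/-!
# Bivariate Bernstein certificates by evaluation: `P(q,u) ≥ 0` on the box `[0,1] × [0,1/s]` from integer coefficient lists

Topic `Literature/Analysis/ValidatedNumerics` (companion of `BernsteinRangeEnclosure.lean`, which proves the Cargo–Shisha /
Garloff–Smith range-enclosing property of the Bernstein expansion for polynomials given as Mathlib `Polynomial`s, the identity
instance being checked by `ring`).  Here the same sign test is set up so that the KERNEL can run it on explicit tables: a
bivariate polynomial is an integer coefficient list `P : List (List ℤ)` (outer index = power of the second variable `u`, inner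
= power of the first variable `q`; `BivBernstein.evalB P q u = Σ_j (Σ_i P_j[i] qⁱ) uʲ`), a certificate is a matrix of integers
`C = (c_{ij})`, and the checker `BivBernstein.bernCert n m s P C` verifies by pure structural list recursion that every `c_{ij} ≥ 0` and
that

  `Σ_{i ≤ n} Σ_{j ≤ m} c_{ij} · qⁱ (1 − q)^{n−i} · (s u)ʲ (1 − s u)^{m−j} = s^m · P(q, u)`            (coefficientwise),

so that `decide` (kernel evaluation) settles it on closed terms.  Soundness (`BivBernstein.evalB_nonneg_of_bernCert`): a passing
certificate gives `0 ≤ P(q,u)` for all real `0 ≤ q ≤ 1`, `0 ≤ u`, `s·u ≤ 1` — each Bernstein basis product is non-negative there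
(Garloff–Smith 2001, §2.1 Lemma 1 (i); Cargo–Shisha 1966).  The integers `c_{ij}` are the tensor Bernstein coefficients of
`s^m P(q, u'/s)` times the binomials `C(n,i)C(m,j)`; producing them (and choosing `n, m, s`) is the certificate's business, not
the checker's.  Also here: the evaluation homomorphism for the list arithmetic (`addB`, `smulB`, `mulB`, `subB`, products with a
polynomial in one variable), so that a ROW polynomial assembled from tables by these operations evaluates to the corresponding
real expression by `simp` — no `ring` normalisation of large expressions is ever needed.

WHAT THIS IS NOT: subdivision / degree elevation strategies, the power-to-Bernstein conversion formula (the certificate supplies the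
result and the checker re-expands it), floating point.  Everything is PROVED; no named facts; no `decide` is run in this file.
-/

namespace Literature.Analysis.ValidatedNumerics

namespace BivBernstein

/-! ### Univariate integer coefficient lists -/

/-- `[c₀, c₁, …] ↦ c₀ + c₁ x + c₂ x² + …` (Horner).
[cite: GarloffSmith2001, §2.1 (coefficient-list arithmetic behind Lemma 1 (i))] -/
def evalU : List ℤ → ℝ → ℝ
  | [], _ => 0
  | c :: p, x => c + x * evalU p x

/-- `evalU [] = 0`. [cite: GarloffSmith2001, §2.1 (coefficient-list arithmetic behind Lemma 1 (i))] -/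
@[simp] theorem evalU_nil (x : ℝ) : evalU [] x = 0 := rfl

/-- Horner step. [cite: GarloffSmith2001, §2.1 (coefficient-list arithmetic behind Lemma 1 (i))] -/
@[simp] theorem evalU_cons (c : ℤ) (p : List ℤ) (x : ℝ) : evalU (c :: p) x = c + x * evalU p x := rfl

/-- Sum of coefficient lists. [cite: GarloffSmith2001, §2.1 (coefficient-list arithmetic behind Lemma 1 (i))] -/
def addU : List ℤ → List ℤ → List ℤ
  | [], q => q
  | p, [] => p
  | a :: p, b :: q => (a + b) :: addU p q

/-- `evalU` is additive. [cite: GarloffSmith2001, §2.1 (coefficient-list arithmetic behind Lemma 1 (i))] -/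
@[simp] theorem evalU_addU : ∀ (p q : List ℤ) (x : ℝ), evalU (addU p q) x = evalU p x + evalU q x
  | [], q, x => by simp [addU]
  | a :: p, [], x => by simp [addU]
  | a :: p, b :: q, x => by
    rw [addU, evalU_cons, evalU_cons, evalU_cons, evalU_addU p q x]
    push_cast; ring

/-- Scalar multiple of a coefficient list. [cite: GarloffSmith2001, §2.1 (coefficient-list arithmetic behind Lemma 1 (i))] -/
def smulU (c : ℤ) : List ℤ → List ℤ
  | [] => []
  | a :: p => (c * a) :: smulU c p

/-- `evalU` commutes with scalars. [cite: GarloffSmith2001, §2.1 (coefficient-list arithmetic behind Lemma 1 (i))] -/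
@[simp] theorem evalU_smulU (c : ℤ) : ∀ (p : List ℤ) (x : ℝ), evalU (smulU c p) x = c * evalU p x
  | [], x => by simp [smulU]
  | a :: p, x => by
    rw [smulU, evalU_cons, evalU_cons, evalU_smulU c p x]
    push_cast; ring

/-- Product of coefficient lists. [cite: GarloffSmith2001, §2.1 (coefficient-list arithmetic behind Lemma 1 (i))] -/
def mulU : List ℤ → List ℤ → List ℤ
  | [], _ => []
  | a :: p, q => addU (smulU a q) (0 :: mulU p q)

/-- `evalU` is multiplicative. [cite: GarloffSmith2001, §2.1 (coefficient-list arithmetic behind Lemma 1 (i))] -/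
@[simp] theorem evalU_mulU : ∀ (p q : List ℤ) (x : ℝ), evalU (mulU p q) x = evalU p x * evalU q x
  | [], q, x => by simp [mulU]
  | a :: p, q, x => by
    rw [mulU, evalU_addU, evalU_smulU, evalU_cons, evalU_cons, evalU_mulU p q x]
    push_cast; ring

/-- Powers of a coefficient list. [cite: GarloffSmith2001, §2.1 (coefficient-list arithmetic behind Lemma 1 (i))] -/
def powU (p : List ℤ) : ℕ → List ℤ
  | 0 => [1]
  | k + 1 => mulU p (powU p k)

/-- `evalU` of a power. [cite: GarloffSmith2001, §2.1 (coefficient-list arithmetic behind Lemma 1 (i))] -/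
@[simp] theorem evalU_powU (p : List ℤ) (x : ℝ) : ∀ k : ℕ, evalU (powU p k) x = evalU p x ^ k
  | 0 => by simp [powU]
  | k + 1 => by rw [powU, evalU_mulU, evalU_powU p x k, pow_succ']

/-- All coefficients vanish (semantic zero test). [cite: GarloffSmith2001, §2.1 (coefficient-list arithmetic behind Lemma 1 (i))] -/
def isZeroU : List ℤ → Bool
  | [] => true
  | a :: p => decide (a = 0) && isZeroU p

/-- A list of zeros evaluates to `0`. [cite: GarloffSmith2001, §2.1 (coefficient-list arithmetic behind Lemma 1 (i))] -/
theorem evalU_eq_zero_of_isZeroU : ∀ {p : List ℤ}, isZeroU p = true → ∀ x : ℝ, evalU p x = 0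
  | [], _, x => rfl
  | a :: p, h, x => by
    simp only [isZeroU, Bool.and_eq_true, decide_eq_true_eq] at h
    rw [evalU_cons, h.1, evalU_eq_zero_of_isZeroU h.2 x]; simp

/-- Coefficientwise equality up to trailing zeros. [cite: GarloffSmith2001, §2.1 (coefficient-list arithmetic behind Lemma 1 (i))] -/
def beqU : List ℤ → List ℤ → Bool
  | [], q => isZeroU q
  | a :: p, [] => isZeroU (a :: p)
  | a :: p, b :: q => decide (a = b) && beqU p q

/-- `beqU` is sound for evaluation. [cite: GarloffSmith2001, §2.1 (coefficient-list arithmetic behind Lemma 1 (i))] -/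
theorem evalU_eq_of_beqU : ∀ {p q : List ℤ}, beqU p q = true → ∀ x : ℝ, evalU p x = evalU q x
  | [], q, h, x => by rw [beqU] at h; rw [evalU_nil, evalU_eq_zero_of_isZeroU h x]
  | a :: p, [], h, x => by rw [beqU] at h; rw [evalU_nil, evalU_eq_zero_of_isZeroU h x]
  | a :: p, b :: q, h, x => by
    simp only [beqU, Bool.and_eq_true, decide_eq_true_eq] at h
    rw [evalU_cons, evalU_cons, h.1, evalU_eq_of_beqU h.2 x]

/-- All coefficients non-negative. [cite: GarloffSmith2001, §2.1 (coefficient-list arithmetic behind Lemma 1 (i))] -/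
def nonnegU : List ℤ → Bool
  | [] => true
  | a :: p => decide (0 ≤ a) && nonnegU p

/-! ### Bivariate integer coefficient lists (outer index: the second variable) -/

/-- `evalB P q u = Σ_j evalU P_j q · uʲ` (Horner in `u`). [cite: GarloffSmith2001, §2.1 (coefficient-list arithmetic behind Lemma 1 (i))] -/
def evalB : List (List ℤ) → ℝ → ℝ → ℝ
  | [], _, _ => 0
  | p :: P, q, u => evalU p q + u * evalB P q u

/-- `evalB [] = 0`. [cite: GarloffSmith2001, §2.1 (coefficient-list arithmetic behind Lemma 1 (i))] -/
@[simp] theorem evalB_nil (q u : ℝ) : evalB [] q u = 0 := rfl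

/-- Horner step in `u`. [cite: GarloffSmith2001, §2.1 (coefficient-list arithmetic behind Lemma 1 (i))] -/
@[simp] theorem evalB_cons (p : List ℤ) (P : List (List ℤ)) (q u : ℝ) :
    evalB (p :: P) q u = evalU p q + u * evalB P q u := rfl

/-- Sum. [cite: GarloffSmith2001, §2.1 (coefficient-list arithmetic behind Lemma 1 (i))] -/
def addB : List (List ℤ) → List (List ℤ) → List (List ℤ)
  | [], Q => Q
  | P, [] => P
  | p :: P, r :: Q => addU p r :: addB P Q

/-- `evalB` is additive. [cite: GarloffSmith2001, §2.1 (coefficient-list arithmetic behind Lemma 1 (i))] -/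
@[simp] theorem evalB_addB : ∀ (P Q : List (List ℤ)) (q u : ℝ), evalB (addB P Q) q u = evalB P q u + evalB Q q u
  | [], Q, q, u => by simp [addB]
  | p :: P, [], q, u => by simp [addB]
  | p :: P, r :: Q, q, u => by
    rw [addB, evalB_cons, evalB_cons, evalB_cons, evalU_addU, evalB_addB P Q q u]; ring

/-- Integer scalar multiple. [cite: GarloffSmith2001, §2.1 (coefficient-list arithmetic behind Lemma 1 (i))] -/
def smulB (c : ℤ) : List (List ℤ) → List (List ℤ)
  | [] => []
  | p :: P => smulU c p :: smulB c P

/-- `evalB` commutes with scalars. [cite: GarloffSmith2001, §2.1 (coefficient-list arithmetic behind Lemma 1 (i))] -/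
@[simp] theorem evalB_smulB (c : ℤ) : ∀ (P : List (List ℤ)) (q u : ℝ), evalB (smulB c P) q u = c * evalB P q u
  | [], q, u => by simp [smulB]
  | p :: P, q, u => by rw [smulB, evalB_cons, evalB_cons, evalU_smulU, evalB_smulB c P q u]; ring

/-- Difference. [cite: GarloffSmith2001, §2.1 (coefficient-list arithmetic behind Lemma 1 (i))] -/
def subB (P Q : List (List ℤ)) : List (List ℤ) := addB P (smulB (-1) Q)

/-- `evalB` of a difference. [cite: GarloffSmith2001, §2.1 (coefficient-list arithmetic behind Lemma 1 (i))] -/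
@[simp] theorem evalB_subB (P Q : List (List ℤ)) (q u : ℝ) : evalB (subB P Q) q u = evalB P q u - evalB Q q u := by
  rw [subB, evalB_addB, evalB_smulB]; push_cast; ring

/-- Product with a polynomial in the first variable `q`. [cite: GarloffSmith2001, §2.1 (coefficient-list arithmetic behind Lemma 1 (i))] -/
def mulUB (a : List ℤ) : List (List ℤ) → List (List ℤ)
  | [] => []
  | p :: P => mulU a p :: mulUB a P

/-- `evalB (a(q) · P)`. [cite: GarloffSmith2001, §2.1 (coefficient-list arithmetic behind Lemma 1 (i))] -/
@[simp] theorem evalB_mulUB (a : List ℤ) : ∀ (P : List (List ℤ)) (q u : ℝ), evalB (mulUB a P) q u = evalU a q * evalB P q u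
  | [], q, u => by simp [mulUB]
  | p :: P, q, u => by rw [mulUB, evalB_cons, evalB_cons, evalU_mulU, evalB_mulUB a P q u]; ring

/-- Product of bivariate lists. [cite: GarloffSmith2001, §2.1 (coefficient-list arithmetic behind Lemma 1 (i))] -/
def mulB : List (List ℤ) → List (List ℤ) → List (List ℤ)
  | [], _ => []
  | p :: P, Q => addB (mulUB p Q) ([] :: mulB P Q)

/-- `evalB` is multiplicative. [cite: GarloffSmith2001, §2.1 (coefficient-list arithmetic behind Lemma 1 (i))] -/
@[simp] theorem evalB_mulB : ∀ (P Q : List (List ℤ)) (q u : ℝ), evalB (mulB P Q) q u = evalB P q u * evalB Q q u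
  | [], Q, q, u => by simp [mulB]
  | p :: P, Q, q, u => by
    rw [mulB, evalB_addB, evalB_mulUB, evalB_cons, evalB_cons, evalU_nil, evalB_mulB P Q q u]; ring

/-- The outer product `a(q) · b(u)` of two univariate lists. [cite: GarloffSmith2001, §2.1 (coefficient-list arithmetic behind Lemma 1 (i))] -/
def outerB (a : List ℤ) : List ℤ → List (List ℤ)
  | [] => []
  | c :: b => smulU c a :: outerB a b

/-- `evalB (a ⊗ b) = a(q) · b(u)`. [cite: GarloffSmith2001, §2.1 (coefficient-list arithmetic behind Lemma 1 (i))] -/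
@[simp] theorem evalB_outerB (a : List ℤ) : ∀ (b : List ℤ) (q u : ℝ), evalB (outerB a b) q u = evalU a q * evalU b u
  | [], q, u => by simp [outerB]
  | c :: b, q, u => by rw [outerB, evalB_cons, evalU_cons, evalU_smulU, evalB_outerB a b q u]; ring

/-- Coefficientwise equality up to trailing zeros. [cite: GarloffSmith2001, §2.1 (coefficient-list arithmetic behind Lemma 1 (i))] -/
def beqB : List (List ℤ) → List (List ℤ) → Bool
  | [], Q => Q.all isZeroU
  | p :: P, [] => (p :: P).all isZeroU
  | p :: P, r :: Q => beqU p r && beqB P Q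

/-- A list of zero rows evaluates to `0`. [cite: GarloffSmith2001, §2.1 (coefficient-list arithmetic behind Lemma 1 (i))] -/
theorem evalB_eq_zero_of_all_isZeroU : ∀ {P : List (List ℤ)}, P.all isZeroU = true → ∀ q u : ℝ, evalB P q u = 0
  | [], _, q, u => rfl
  | p :: P, h, q, u => by
    simp only [List.all_cons, Bool.and_eq_true] at h
    rw [evalB_cons, evalU_eq_zero_of_isZeroU h.1 q, evalB_eq_zero_of_all_isZeroU h.2 q u]; simp

/-- `beqB` is sound for evaluation. [cite: GarloffSmith2001, §2.1 (coefficient-list arithmetic behind Lemma 1 (i))] -/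
theorem evalB_eq_of_beqB : ∀ {P Q : List (List ℤ)}, beqB P Q = true → ∀ q u : ℝ, evalB P q u = evalB Q q u
  | [], Q, h, q, u => by rw [beqB] at h; rw [evalB_nil, evalB_eq_zero_of_all_isZeroU h q u]
  | p :: P, [], h, q, u => by rw [beqB] at h; rw [evalB_nil, evalB_eq_zero_of_all_isZeroU h q u]
  | p :: P, r :: Q, h, q, u => by
    simp only [beqB, Bool.and_eq_true] at h
    rw [evalB_cons, evalB_cons, evalU_eq_of_beqU h.1 q, evalB_eq_of_beqB h.2 q u]

/-- All coefficients non-negative. [cite: GarloffSmith2001, §2.1 (coefficient-list arithmetic behind Lemma 1 (i))] -/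
def nonnegB : List (List ℤ) → Bool
  | [] => true
  | p :: P => nonnegU p && nonnegB P

/-! ### The Bernstein expansion and the checker -/

/-- `qⁱ (1 − q)^{k}` as a coefficient list in `q`. [cite: GarloffSmith2001, §2.1 (definition of b_{n,i})] -/
def bernU (i k : ℕ) : List ℤ := mulU (powU [0, 1] i) (powU [1, -1] k)

/-- `evalU (bernU i k) q = qⁱ (1 − q)ᵏ`. [cite: GarloffSmith2001, §2.1 (definition of b_{n,i})] -/
theorem evalU_bernU (i k : ℕ) (q : ℝ) : evalU (bernU i k) q = q ^ i * (1 - q) ^ k := by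
  simp [bernU, sub_eq_add_neg]

/-- `(s u)ʲ (1 − s u)^{k}` as a coefficient list in `u`. [cite: GarloffSmith2001, §2.1 (definition of b_{n,i})] -/
def bernUs (s : ℤ) (j k : ℕ) : List ℤ := mulU (powU [0, s] j) (powU [1, -s] k)

/-- `evalU (bernUs s j k) u = (s u)ʲ (1 − s u)ᵏ`. [cite: GarloffSmith2001, §2.1 (definition of b_{n,i})] -/
theorem evalU_bernUs (s : ℤ) (j k : ℕ) (u : ℝ) : evalU (bernUs s j k) u = (s * u) ^ j * (1 - s * u) ^ k := by
  simp [bernUs]; ring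

/-- One row of the expansion: `Σ_j c_j · (s u)ʲ (1 − s u)^{m−j}` as a list in `u`, the `c_j` read from position `j`.
[cite: GarloffSmith2001, §2.1 (coefficient-list arithmetic behind Lemma 1 (i))] -/
def rowBern (s : ℤ) (m : ℕ) : ℕ → List ℤ → List ℤ
  | _, [] => []
  | j, c :: cs => addU (smulU c (bernUs s j (m - j))) (rowBern s m (j + 1) cs)

/-- The value of a row with non-negative entries is non-negative on `0 ≤ u`, `s u ≤ 1`.
[cite: GarloffSmith2001, §2.1 Lemma 1 (i) (proof ingredient)] -/
theorem evalU_rowBern_nonneg (s : ℤ) (m : ℕ) {u : ℝ} (hu : 0 ≤ u) (hs : 0 ≤ (s : ℝ)) (hsu : (s : ℝ) * u ≤ 1) :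
    ∀ (j : ℕ) {cs : List ℤ}, nonnegU cs = true → 0 ≤ evalU (rowBern s m j cs) u
  | j, [], _ => by simp [rowBern]
  | j, c :: cs, h => by
    simp only [nonnegU, Bool.and_eq_true, decide_eq_true_eq] at h
    rw [rowBern, evalU_addU, evalU_smulU, evalU_bernUs]
    have hc : (0 : ℝ) ≤ c := by exact_mod_cast h.1
    have h1 : 0 ≤ ((s : ℝ) * u) ^ j * (1 - s * u) ^ (m - j) :=
      mul_nonneg (pow_nonneg (mul_nonneg hs hu) _) (pow_nonneg (sub_nonneg.2 hsu) _)
    have h2 := evalU_rowBern_nonneg s m hu hs hsu (j + 1) h.2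
    positivity

/-- The full expansion `Σ_i qⁱ(1 − q)^{n−i} ⊗ (row i)`, the rows read from position `i`.
[cite: GarloffSmith2001, §2.1 (coefficient-list arithmetic behind Lemma 1 (i))] -/
def bernExpand (n m : ℕ) (s : ℤ) : ℕ → List (List ℤ) → List (List ℤ)
  | _, [] => []
  | i, cs :: C => addB (outerB (bernU i (n - i)) (rowBern s m 0 cs)) (bernExpand n m s (i + 1) C)

/-- The value of the expansion with non-negative entries is non-negative on the box. [cite: GarloffSmith2001, §2.1 Lemma 1 (i)] -/
theorem evalB_bernExpand_nonneg (n m : ℕ) (s : ℤ) {q u : ℝ} (hq0 : 0 ≤ q) (hq1 : q ≤ 1) (hu : 0 ≤ u)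
    (hs : 0 ≤ (s : ℝ)) (hsu : (s : ℝ) * u ≤ 1) :
    ∀ (i : ℕ) {C : List (List ℤ)}, nonnegB C = true → 0 ≤ evalB (bernExpand n m s i C) q u
  | i, [], _ => by simp [bernExpand]
  | i, cs :: C, h => by
    simp only [nonnegB, Bool.and_eq_true] at h
    rw [bernExpand, evalB_addB, evalB_outerB, evalU_bernU]
    have h1 : 0 ≤ q ^ i * (1 - q) ^ (n - i) := mul_nonneg (pow_nonneg hq0 _) (pow_nonneg (sub_nonneg.2 hq1) _)
    have h2 := evalU_rowBern_nonneg s m hu hs hsu 0 h.1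
    have h3 := evalB_bernExpand_nonneg n m s hq0 hq1 hu hs hsu (i + 1) h.2
    positivity

/-- **The checker**: all certificate entries non-negative, and the Bernstein expansion of the certificate equals `s^m · P`
coefficientwise (`n`, `m` are the degrees in `q` and `u` used for the basis, `s ≥ 1` the inverse width in `u`). Pure structural
recursion on lists: meant to be run by `decide` on explicit tables. [cite: GarloffSmith2001, §2.1 Lemma 1 (i) eq. (3)] -/
def bernCert (n m s : ℕ) (P C : List (List ℤ)) : Bool :=
  nonnegB C && beqB (bernExpand n m s 0 C) (smulB ((s : ℤ) ^ m) P)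

/-- ★ **Soundness of the Bernstein certificate**: if `bernCert n m s P C` passes then `P(q,u) ≥ 0` for all real
`0 ≤ q ≤ 1`, `0 ≤ u` with `s·u ≤ 1` (`s ≥ 1`). [cite: GarloffSmith2001, §2.1 Lemma 1 (i) eq. (3)] -/
theorem evalB_nonneg_of_bernCert {n m s : ℕ} {P C : List (List ℤ)} (h : bernCert n m s P C = true) (hs : 1 ≤ s)
    {q u : ℝ} (hq0 : 0 ≤ q) (hq1 : q ≤ 1) (hu : 0 ≤ u) (hsu : (s : ℝ) * u ≤ 1) : 0 ≤ evalB P q u := by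
  simp only [bernCert, Bool.and_eq_true] at h
  have hexp := evalB_bernExpand_nonneg n m (s : ℤ) hq0 hq1 hu (by exact_mod_cast (Nat.zero_le s))
    (by exact_mod_cast hsu) 0 h.1
  rw [evalB_eq_of_beqB h.2 q u, evalB_smulB] at hexp
  push_cast at hexp
  have hsm : (0 : ℝ) < (s : ℝ) ^ m := pow_pos (by exact_mod_cast hs) m
  exact (mul_nonneg_iff_of_pos_left hsm).1 hexp

/-- The strict form: if `bernCert n m s (P − L) C` passes for a list `L` with `0 < evalB L q u`, then `0 < P(q,u)` on the box.
[cite: GarloffSmith2001, §2.1 Lemma 1 (i) eq. (3)] -/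
theorem evalB_pos_of_bernCert_sub {n m s : ℕ} {P L C : List (List ℤ)} (h : bernCert n m s (subB P L) C = true) (hs : 1 ≤ s)
    {q u : ℝ} (hq0 : 0 ≤ q) (hq1 : q ≤ 1) (hu : 0 ≤ u) (hsu : (s : ℝ) * u ≤ 1) (hL : 0 < evalB L q u) :
    0 < evalB P q u := by
  have := evalB_nonneg_of_bernCert h hs hq0 hq1 hu hsu
  rw [evalB_subB] at this
  linarith

/-! ### A worked micro-example (documentation; `decide` is NOT run in this file)

For `P(q,u) = q(1 − q) + u(1 − 2u) ≥ 0` on `[0,1] × [0,1/2]` one takes `n = 2`, `m = 2`, `s = 2` and the certificate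
`C = [[0,1,0],[2,3,2],[0,1,0]]` (rows `i = 0,1,2`, columns `j = 0,1,2`): indeed
`4P = Σ c_{ij} qⁱ(1−q)^{2−i}(2u)ʲ(1−2u)^{2−j}`; a user file states `example : bernCert 2 2 2 P C = true := by decide`. -/

/-- The constant list `[[c]]` evaluates to `c`. [cite: GarloffSmith2001, §2.1 (coefficient-list arithmetic behind Lemma 1 (i))] -/
@[simp] theorem evalB_const (c : ℤ) (q u : ℝ) : evalB [[c]] q u = c := by simp

/-- The list `[[0, 1]]` evaluates to `q`. [cite: GarloffSmith2001, §2.1 (coefficient-list arithmetic behind Lemma 1 (i))] -/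
@[simp] theorem evalB_varQ (q u : ℝ) : evalB [[0, 1]] q u = q := by simp

/-- The list `[[], [1]]` evaluates to `u`. [cite: GarloffSmith2001, §2.1 (coefficient-list arithmetic behind Lemma 1 (i))] -/
@[simp] theorem evalB_varU (q u : ℝ) : evalB [[], [1]] q u = u := by simp

end BivBernstein

end Literature.Analysis.ValidatedNumerics
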